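import Literature.InformationTheory.QuantumCodes.ConnectivityDistanceBound
import Literature.Combinatorics.SimpleGraph.TreeDecompositionRooting
import HarnessLib

/-!
# Connectivity constrains quantum codes: the treewidth bound on the distance (Baspin–Krishna 2022,
# Theorem 17) — PROVED, and without the degree

N. Baspin, A. Krishna, *Connectivity constrains quantum codes*, Quantum 6 (2022) 711 = arXiv:2106.00765
[BaspinKrishna2022] (held text `paper:arxiv-2106.00765`), §2.2 and §3.1, read on the page:

> «Definition 13. A tree decomposition of a graph G = (V,E) is a pair ({Q(i), i ∈ ℐ}, 𝒯 = (ℐ,ℰ)) where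
> {i : i ∈ I} is a family of subsets Q(i) ⊆ V and 𝒯 = (ℐ,ℰ) is a tree … (1) ⋃_{i∈ℐ} Q(i) = V, (2) for
> every edge {v,w} ∈ E there exists i ∈ ℐ with {v,w} ⊆ Q(i), (3) for every i,j,k ∈ ℐ the following
> holds: if j lies on the path from i to k in 𝒯, then Q(i) ∩ Q(k) ⊆ Q(j). The width of the tree
> decomposition … is max_{i∈ℐ} |Q(i)| − 1. The treewidth tw(G) of G is the minimum width of a tree
> decomposition of G.» (chunk p0009 L22–35)
> «Theorem 17. Let 𝒞 be a code and G = G(𝒞) be the corresponding connectivity graph of bounded degree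
> δ. If G has treewidth tw(G) then the distance obeys d ≤ δ·(tw(G)+1).» (chunk p0011 L7–10)
> Proof (chunk p0011 L12–66): by contradiction (`d > δ(tw(G)+1)`); for the leaves `j₁,…,j_t` below a
> node `p` of depth `𝒟 − 1` the anchor «𝒜 = ⋃ᵢ Q(jᵢ) ∖ ⋃ᵢ ∂₊Q(jᵢ)» is correctable (Union Lemma), the
> extended parent «𝒫_ext = Q(p) ∪ ∂₊Q(p)» has «|∂₊Q(p)| ≤ δ(tw(n)+1)» qubits in its boundary part and is
> correctable, «∂₋Q(jᵢ) ⊂ Q(p)» by Property (3), «∂₊𝒜 ⊂ ⋃ᵢ ∂₊Q(jᵢ) ⊂ 𝒫_ext», so «⋃ᵢ Q(jᵢ) ∪ Q(p) ⊂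
> 𝒜 ∪ 𝒫_ext is correctable» (Expansion Lemma); «We can combine these nodes to form one larger leaf … This
> process can be iterated until the entire tree becomes one giant node which itself must be correctable
> … a contradiction if the code is to encode at least one logical qubit.»
> §5, open questions (chunk p0017 L21): «Can our bound on the distance from the treewidth be made
> independent from the maximum degree of the connectivity graph?»

What this file proves (KERNEL, no named fact), for stabilizer codes `S̄ = ⟨g⟩` presented by a generator
family `g` (connectivity graph `connGraph g`, `ConnectivityDimensionBound.lean`), on the tree's
vocabulary of tree decompositions (`Literature/Combinatorics/SimpleGraph/TreeDecomposition.lean`: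
`TreeDecomposition`, `width`, `treewidth`; breadth-first rooting `root`, `depth`, `parentNode`,
`mem_bag_parentNode` of `TreeDecompositionRooting.lean`) and correctable regions
(`CorrectableRegions.lean`, `ConnectivityDistanceBound.lean`):
* `TreewidthBound.IsBelow`, `TreewidthBound.below` (`V_t`, the qubits of the bags below a node) and
  the Property-(3) lemmas of the printed proof in rooted form
  (`mem_bag_of_isBelow_of_not_isBelow`, `mem_bag_parent_of_isBelow_of_not_isBelow`,
  `eq_of_isBelow_of_isBelow`);
* `TreewidthBound.coversOuterBoundary_below_sdiff` — `∂₊(V_t ∖ Q(t)) ⊆ Q(t)`;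
* **`TreewidthBound.isCorrectableRegion_below`** — the contraction: if every bag has `< d` qubits then
  every `V_t` is correctable (leaves up; Union Lemma over the children, Expansion Lemma with `Q(t)`);
* **`BaspinKrishna2022_theorem17`** — Theorem 17 as printed (`d ≤ δ·(tw(G)+1)`, `δ ≥ 1` a degree bound).

ROUTE DIFFERS FROM PRINT IN ONE POINT; STATEMENT AS PRINTED. The printed
anchor `⋃ᵢ Q(jᵢ) ∖ ⋃ᵢ ∂₊Q(jᵢ)` must be extended by `𝒫_ext = Q(p) ∪ ∂₊Q(p)`, whose size is where the
degree `δ` enters. This file uses the anchor `V_c ∖ Q(p)` for the subtree below a child `c` of `p`: by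
Properties (2)–(3) its outer boundary lies inside `Q(p)` itself (`coversOuterBoundary_below_sdiff`), the
anchors of distinct children are disjoint and joined by no edge, so the Union Lemma and the Expansion
Lemma (with `Q(p)`, `|Q(p)| ≤ tw(G)+1 < d`) contract the children into the parent exactly as in print —
and the degree never enters the engine `TreewidthBound.isCorrectableRegion_below` (hypothesis: all bags
have `< d` qubits). The degree-free CONSEQUENCE `d ≤ tw(G) + 1` is not a printed statement (Baspin–
Krishna ask for it: §5, quoted above; Baspin–Guruswami–Krishna–Li, arXiv:2307.03283 Theorem 1.1 = the
tree's `BaspinEtAl2024_theorem11`, remove the degree for SEPARATION PROFILES; N. Baspin, arXiv:2503.17655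
Theorem 9, bounds `d` for Assouad dimension `< 2`, a bounded-degree regime) and is therefore NOT stated in
this Literature file: by the cell lead's ruling (qec INBOX 2026-08-27T14:04:43Z) it is recorded on the
Summits side (`Summits/Ventures/QEC/Connectivity/TreewidthDistanceBound.lean`, theorem
`distance_le_treewidth_add_one`, importing the engine from here). This file states only the printed
Theorem 17.

FAITHFULNESS / SCOPE: (a) stabilizer (additive) codes, as in the printed Theorem 17 (the commuting-
projector version, App. Theorem 36 with `8δ²tw(G)`, is not typed); (b) `k ≥ 1` explicit (the printed
«if the code is to encode at least one logical qubit»); (c) the printed degree hypothesis is carried by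
`BaspinKrishna2022_theorem17` as `∀ v, deg v ≤ δ` with `δ ≥ 1` (for `δ = 0` the printed `d ≤ 0` fails for
the `[[1,1,1]]` code) and is not used; (d) tree decompositions are the tree's (indexed by `Fin m`,
Mathlib `SimpleGraph.IsTree`), `treewidth` the least width — Definition 13 verbatim; (e) NOT typed:
Lemma 14 / Lemma 16 (separator–treewidth–expansion comparisons, cited from the graph-theory literature),
Corollary 18 (asymptotic), §3.3, §4.

HONEST FRAMING (LADDER-QEC X1): a BARRIER theorem — a stabilizer code whose connectivity graph (for some
generating set) has treewidth `w` and degree `≤ δ` has distance at most `δ(w + 1)`. A 2022 theorem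
formalized; no novelty word.

## References
* [BaspinKrishna2022] §2.1 Defs 4–7, Lemma 8 (Union), Lemma 9 (Expansion), Def 10 (connectivity graph);
  §2.2 Def 13 (tree decomposition, treewidth; chunk p0009 L22–35); §3.1 Theorem 17 and proof (chunk p0011
  L5–66); §5 (chunk p0017 L19–21).
* [BaspinEtAl2024] N. Baspin, V. Guruswami, A. Krishna, R. Li, arXiv:2307.03283, Lemma 2.3 (Expansion
  Lemma, ∂₊ form — the tree's `IsCorrectableRegion.union_of_coversOuterBoundary`).
* [BravyiPoulinTerhal2010] Union Lemma (the tree's `isCorrectableRegion_of_fibers`).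
* N. Baspin, *Stabilizer codes of less than two dimensions have constant distance*, arXiv:2503.17655
  (2025), Theorem 9 (read for the prior-art check; not used).

## Mathlib / tree search
`rg -i 'treewidth|TreeDecomposition' Literature Summits` (2026-08-27): the tree decompositions live in
`Literature/Combinatorics/SimpleGraph/TreeDecomposition*.lean` (Markov–Shi / Robertson–Seymour form,
`treewidth`, breadth-first rooting) and are reused here; no quantum-code use before this file
(`ConnectivityDimensionBound.lean` docstring: «Theorem 17 / Theorem 1 (tree decompositions — no Mathlib
treewidth) NOT typed»). Mathlib has no tree decompositions. Reused: `connGraph`, `connGraph_adj`,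
`CoversOuterBoundary`, `IsCorrectableRegion(.mono/.of_card_lt/.union_of_coversOuterBoundary)`,
`isCorrectableRegion_of_fibers`, `fiber`, `not_isCorrectableRegion_univ`, `TreeDecomposition`
(`exists_mem_bag`, `exists_mem_bag_of_adj`, `card_bag_le_width_add_one`, `exists_width_eq_treewidth`,
`root`, `depth`, `depth_eq_zero_iff`, `parentNode`, `depth_parentNode`, `rank`, `rank_lt`,
`rank_parentNode_lt`, `mem_bag_parentNode`).
-/

namespace Literature.InformationTheory.QuantumCodes

open Finset
open Literature.Combinatorics.SimpleGraph (TreeDecomposition treewidth)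

variable {n : ℕ} {G : Type*} (g : G → SympVec n)

namespace TreewidthBound

open Literature.Combinatorics.SimpleGraph.TreeDecomposition

variable {m : ℕ} (D : TreeDecomposition (connGraph g) (Fin m))

/-! ### Descendants in the breadth-first rooting -/

/-- `t` is an ancestor-or-self of `s` in the breadth-first rooting of the decomposition tree
(`Literature.Combinatorics.SimpleGraph.TreeDecompositionRooting`): some iterate of the parent map
takes `s` to `t`. (definition) [cite: BaspinKrishna2022, §3.1 Theorem 17, proof («Suppose the tree 𝒯 is non-trivial and has depth 𝒟 ≥ 1 (and the root at depth 0)»; arXiv:2106.00765 chunk p0011 L14–16)] -/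
def IsBelow (t s : Fin m) : Prop := ∃ i : ℕ, (D.parentNode)^[i] s = t

/-- The root is its own parent. [folklore] -/
private theorem parentNode_root : D.parentNode D.root = D.root := by
  unfold Literature.Combinatorics.SimpleGraph.TreeDecomposition.parentNode
  rw [if_pos rfl]

/-- The parent is not deeper. [folklore] -/
private theorem depth_parentNode_le (t : Fin m) : D.depth (D.parentNode t) ≤ D.depth t := by
  by_cases ht : t = D.root
  · rw [ht, parentNode_root]
  · have := depth_parentNode ht; omega

/-- Ancestors are not deeper. [folklore] -/
private theorem depth_iterate_le (i : ℕ) (t : Fin m) : D.depth ((D.parentNode)^[i] t) ≤ D.depth t := by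
  induction i generalizing t with
  | zero => exact le_rfl
  | succ i ih => rw [Function.iterate_succ_apply]; exact (ih _).trans (depth_parentNode_le g D t)

/-- Every node is below the root. [folklore] -/
private theorem isBelow_root (s : Fin m) : IsBelow g D D.root s := by
  suffices h : ∀ k : ℕ, ∀ s : Fin m, D.depth s = k → IsBelow g D D.root s from h _ s rfl
  intro k
  induction k with
  | zero => intro s hs; exact ⟨0, (D.depth_eq_zero_iff.1 hs)⟩
  | succ k ih =>
    intro s hs
    have hs0 : s ≠ D.root := fun h => by rw [D.depth_eq_zero_iff.2 h] at hs; exact Nat.succ_ne_zero k hs.symm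
    obtain ⟨i, hi⟩ := ih (D.parentNode s) (by have := depth_parentNode hs0; omega)
    exact ⟨i + 1, by rw [Function.iterate_succ_apply]; exact hi⟩

/-- Every node is below itself. [folklore] -/
private theorem isBelow_refl (t : Fin m) : IsBelow g D t t := ⟨0, rfl⟩

/-- A child of a node below `t` is below `t`. [folklore] -/
private theorem IsBelow.of_parentNode {t s : Fin m} (h : IsBelow g D t (D.parentNode s)) : IsBelow g D t s := by
  obtain ⟨i, hi⟩ := h
  exact ⟨i + 1, by rw [Function.iterate_succ_apply]; exact hi⟩

/-- Below is transitive. [folklore] -/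
private theorem IsBelow.trans {t s r : Fin m} (h₁ : IsBelow g D t s) (h₂ : IsBelow g D s r) : IsBelow g D t r := by
  obtain ⟨i, hi⟩ := h₁
  obtain ⟨j, hj⟩ := h₂
  exact ⟨i + j, by rw [Function.iterate_add_apply, hj, hi]⟩

/-- **(T3) along the rooting, upward («the climbing»):** a vertex of the bag of `a ≠ root` that also
lies in the bag of a node not below `a` lies in the bag of the parent of `a`.
[cite: BaspinKrishna2022, §2.2 Definition 13 (T3: «if j lies on the path from i to k in 𝒯, then Q(i) ∩ Q(k) ⊆ Q(j)»; chunk p0009 L24–32)] -/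
theorem mem_bag_parentNode_of_not_isBelow {u : Fin n} {a s : Fin m} (hua : u ∈ D.bag a) (hus : u ∈ D.bag s)
    (hs : ¬ IsBelow g D a s) (ha : a ≠ D.root) : u ∈ D.bag (D.parentNode a) := by
  induction hk : D.depth s using Nat.strong_induction_on generalizing s with
  | _ k ih =>
    by_cases hdepth : D.depth s ≤ D.depth a
    · exact mem_bag_parentNode hua hus (fun h => hs (h ▸ isBelow_refl g D a)) hdepth ha
    · have hs0 : s ≠ D.root := fun h => by
        rw [h, D.depth_eq_zero_iff.2 rfl] at hdepth; exact hdepth (Nat.zero_le _)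
      have hup : u ∈ D.bag (D.parentNode s) :=
        mem_bag_parentNode hus hua (fun h => hs (h ▸ isBelow_refl g D a)) (by omega) hs0
      have hs' : ¬ IsBelow g D a (D.parentNode s) := fun h => hs (h.of_parentNode g D)
      exact ih (D.depth (D.parentNode s)) (by have := depth_parentNode hs0; omega) hup hs' rfl

/-- **(T3) along the rooting, downward:** a vertex of a bag below `a` that also lies in the bag of a
node not below `a` lies in the bag of `a`.
[cite: BaspinKrishna2022, §2.2 Definition 13 (T3; chunk p0009 L24–32) and §3.1 Theorem 17, proof («By Property (connectivity) … it follows that u ∈ Q(p). We conclude that ∂₋Q(jᵢ) ⊂ Q(p)»; chunk p0011 L43–46)] -/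
theorem mem_bag_of_isBelow_of_not_isBelow {u : Fin n} {a s₀ s : Fin m} (hu₀ : u ∈ D.bag s₀)
    (h₀ : IsBelow g D a s₀) (hus : u ∈ D.bag s) (hs : ¬ IsBelow g D a s) : u ∈ D.bag a := by
  obtain ⟨i, hi⟩ := h₀
  induction i generalizing s₀ with
  | zero => exact hi ▸ hu₀
  | succ i ih =>
    rw [Function.iterate_succ_apply] at hi
    by_cases hs₀ : s₀ = D.root
    · rw [hs₀, parentNode_root] at hi
      rw [hs₀] at hu₀
      exact ih hu₀ hi
    · have hbelow : IsBelow g D a s₀ := ⟨i + 1, by rw [Function.iterate_succ_apply]; exact hi⟩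
      exact ih (mem_bag_parentNode_of_not_isBelow g D hu₀ hus (fun h => hs (hbelow.trans g D h)) hs₀) hi

/-- Bags below a CHILD `c` of `t` that meet a bag not below `c` meet the bag of `t`.
[cite: BaspinKrishna2022, §3.1 Theorem 17, proof (chunk p0011 L43–48)] -/
theorem mem_bag_parent_of_isBelow_of_not_isBelow {u : Fin n} {c s₀ s : Fin m} (hc : c ≠ D.root)
    (hu₀ : u ∈ D.bag s₀) (h₀ : IsBelow g D c s₀) (hus : u ∈ D.bag s) (hs : ¬ IsBelow g D c s) :
    u ∈ D.bag (D.parentNode c) :=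
  mem_bag_parentNode_of_not_isBelow g D (mem_bag_of_isBelow_of_not_isBelow g D hu₀ h₀ hus hs) hus hs hc

/-- Distinct children of a node have disjoint subtrees. [folklore] -/
private theorem eq_of_isBelow_of_isBelow {t c c' s : Fin m} (hc : D.parentNode c = t) (hc0 : c ≠ D.root)
    (hc' : D.parentNode c' = t) (hc'0 : c' ≠ D.root) (h : IsBelow g D c s) (h' : IsBelow g D c' s) : c = c' := by
  -- the two witnesses `parent^[i] s = c`, `parent^[j] s = c'`
  suffices key : ∀ {c c' : Fin m} {i j : ℕ}, i ≤ j → D.parentNode c = t → c' ≠ D.root → D.parentNode c' = t →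
      (D.parentNode)^[i] s = c → (D.parentNode)^[j] s = c' → c = c' by
    obtain ⟨i, hi⟩ := h
    obtain ⟨j, hj⟩ := h'
    rcases le_total i j with hij | hij
    · exact key hij hc hc'0 hc' hi hj
    · exact (key hij hc' hc0 hc hj hi).symm
  intro c c' i j hij hc hc'0 hc' hi hj
  obtain ⟨l, rfl⟩ := Nat.exists_eq_add_of_le hij
  rcases l with _ | l
  · rw [Nat.add_zero] at hj; exact hi.symm.trans hj
  · -- c' = parent^[l+1] c = parent^[l] t is an ancestor of t, but it is a child of t: depths clash
    exfalso
    have h1 : (D.parentNode)^[l + 1] c = c' := by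
      rw [← hi, ← Function.iterate_add_apply, Nat.add_comm]; exact hj
    rw [Function.iterate_succ_apply, hc] at h1
    have h2 := depth_iterate_le g D l t
    rw [h1] at h2
    have h3 := depth_parentNode hc'0
    rw [hc'] at h3
    omega

/-! ### The vertices below a node -/

/-- The vertices of the bags below `t` (`V_t = ⋃_{s below t} Q(s)`). (definition)
[cite: BaspinKrishna2022, §3.1 Theorem 17, proof («We can combine these nodes to form one larger leaf»; chunk p0011 L53–58)] -/
noncomputable def below (t : Fin m) : Finset (Fin n) := by
  classical
  exact univ.filter fun v => ∃ s, IsBelow g D t s ∧ v ∈ D.bag s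

/-- Membership in `V_t`. [cite: BaspinKrishna2022, §3.1 Theorem 17, proof (chunk p0011 L53–58)] -/
theorem mem_below {t : Fin m} {v : Fin n} : v ∈ below g D t ↔ ∃ s, IsBelow g D t s ∧ v ∈ D.bag s := by
  unfold below
  simp only [mem_filter, mem_univ, true_and]

/-- `V_root` is everything ((T1)). [cite: BaspinKrishna2022, §2.2 Definition 13 (T1; chunk p0009 L27)] -/
theorem below_root : below g D D.root = univ := by
  ext v
  simp only [mem_below, mem_univ, iff_true]
  obtain ⟨s, hs⟩ := D.exists_mem_bag v
  exact ⟨s, isBelow_root g D s, hs⟩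

/-! ### The contraction step: every `V_t` is correctable when all bags are small -/

variable {S : Submodule (ZMod 2) (SympVec n)} {k d : ℕ}

/-- **The anchor has its outer boundary in the bag of `t`:** every generator meeting
`V_t ∖ Q(t)` is supported in `V_t`, so its qubits outside `V_t ∖ Q(t)` lie in `Q(t)` (an edge of the
connectivity graph lies in a bag (T2); a bag meeting a vertex below `t` that is missing from `Q(t)`
is itself below `t` (T3)). [cite: BaspinKrishna2022, §3.1 Theorem 17, proof («We conclude that ∂₊𝒜 ⊂ ⋃ᵢ ∂₊Q(jᵢ) … ⊂ 𝒫_ext»; chunk p0011 L29–48)] -/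
theorem coversOuterBoundary_below_sdiff (t : Fin m) :
    CoversOuterBoundary g (below g D t \ D.bag t) (D.bag t) := by
  intro a q hq q' hq' hqA hq'A
  rw [mem_sdiff, mem_below] at hqA
  obtain ⟨⟨s₀, hs₀, hqs₀⟩, hqt⟩ := hqA
  have hne : q ≠ q' := fun h => hq'A (h ▸ mem_sdiff.2 ⟨(mem_below g D).2 ⟨s₀, hs₀, hqs₀⟩, hqt⟩)
  obtain ⟨s, hqs, hq's⟩ := D.exists_mem_bag_of_adj (show (connGraph g).Adj q q' from ⟨hne, a, hq, hq'⟩)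
  by_cases hs : IsBelow g D t s
  · by_contra hq't
    exact hq'A (mem_sdiff.2 ⟨(mem_below g D).2 ⟨s, hs, hq's⟩, hq't⟩)
  · exact absurd (mem_bag_of_isBelow_of_not_isBelow g D hqs₀ hs₀ hqs hs) hqt

/-- **All bags small ⇒ every `V_t` is correctable** (the contraction of the printed proof, run from
the leaves up; induction on the breadth-first number of `t`, children carrying larger numbers). Step:
the anchor `𝒜 = V_t ∖ Q(t)` is the disjoint, decoupled union over the children `c` of `t` of
`V_c ∖ Q(t)` (subtrees of distinct children share only vertices of `Q(t)` and are joined by no edge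
avoiding `Q(t)`), each inside the correctable `V_c` — so `𝒜` is correctable (Union Lemma); `∂₊𝒜 ⊆ Q(t)`
and `|Q(t)| < d` — so `𝒜 ∪ Q(t) = V_t` is correctable (Expansion Lemma). The printed anchor is
`⋃ᵢ Q(jᵢ) ∖ ⋃ᵢ ∂₊Q(jᵢ)`, extended by `𝒫_ext = Q(p) ∪ ∂₊Q(p)`; with the anchor `V_c ∖ Q(p)` the
extension by `Q(p)` alone suffices, and the degree of the graph does not enter.
[cite: BaspinKrishna2022, §3.1 Theorem 17, proof (chunk p0011 L12–66)] -/
theorem isCorrectableRegion_below (hcode : IsAdditiveCode S k d)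
    (hS : S = Submodule.span (ZMod 2) (Set.range g)) (hbags : ∀ t, #(D.bag t) < d) (t : Fin m) :
    IsCorrectableRegion S (below g D t) := by
  classical
  induction hμ : m - D.rank t using Nat.strong_induction_on generalizing t with
  | _ μ ih =>
    subst hμ
    have hd : 0 < d := by have := hbags t; omega
    -- the subtrees of the children are correctable
    have hchild : ∀ c : Fin m, D.parentNode c = t → c ≠ D.root → IsCorrectableRegion S (below g D c) := by
      intro c hc hc0
      have h1 := rank_parentNode_lt hc0
      rw [hc] at h1
      have h2 := D.rank_lt c
      exact ih (m - D.rank c) (by omega) c rfl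
    set A : Finset (Fin n) := below g D t \ D.bag t with hA
    -- every vertex of the anchor lies below a child of t
    have hAchild : ∀ v ∈ A, ∃ c, D.parentNode c = t ∧ c ≠ D.root ∧ v ∈ below g D c := by
      intro v hv
      rw [hA, mem_sdiff, mem_below] at hv
      obtain ⟨⟨s, hex, hvs⟩, hvt⟩ := hv
      have hj := Nat.find_spec hex
      have hj0 : Nat.find hex ≠ 0 := fun h => by
        rw [h, Function.iterate_zero_apply] at hj
        exact hvt (hj ▸ hvs)
      obtain ⟨j', hj'⟩ := Nat.exists_eq_succ_of_ne_zero hj0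
      have hct : (D.parentNode)^[j'] s ≠ t := Nat.find_min hex (by omega)
      rw [hj', Function.iterate_succ_apply'] at hj
      refine ⟨(D.parentNode)^[j'] s, hj, fun h => hct ?_, (mem_below g D).2 ⟨s, ⟨j', rfl⟩, hvs⟩⟩
      rw [← hj, h, parentNode_root]
    -- the labelling of the anchor by the children
    set β : Fin n → Option (Fin m) := fun v =>
      if h : v ∈ A then some (Classical.choose (hAchild v h)) else none with hβ
    have hβsome : ∀ v c, β v = some c → v ∈ A ∧ D.parentNode c = t ∧ c ≠ D.root ∧ v ∈ below g D c := by
      intro v c hvc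
      by_cases h : v ∈ A
      · have hvc' : Classical.choose (hAchild v h) = c := by
          simpa [hβ, h] using hvc
        obtain ⟨h1, h2, h3⟩ := Classical.choose_spec (hAchild v h)
        rw [hvc'] at h1 h2 h3
        exact ⟨h, h1, h2, h3⟩
      · simp [hβ, h] at hvc
    -- a bag meeting a vertex of the anchor below the child c is below c (else the vertex is in Q(t))
    have hbag_below : ∀ v c s, v ∈ A → D.parentNode c = t → c ≠ D.root → v ∈ below g D c →
        v ∈ D.bag s → IsBelow g D c s := by
      intro v c s hvA hc hc0 hvc hvs
      by_contra hs
      obtain ⟨s₀, hs₀, hvs₀⟩ := (mem_below g D).1 hvc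
      have h := mem_bag_parent_of_isBelow_of_not_isBelow g D hc0 hvs₀ hs₀ hvs hs
      rw [hc] at h
      exact (mem_sdiff.1 hvA).2 h
    -- every generator meets at most one block
    have hsep : ∀ a, ∀ q ∈ sympSupport (g a), ∀ q' ∈ sympSupport (g a), ∀ c c' : Fin m,
        β q = some c → β q' = some c' → c = c' := by
      intro a q hq q' hq' c c' hqc hq'c'
      obtain ⟨hqA, hc, hc0, hqc₁⟩ := hβsome q c hqc
      obtain ⟨hq'A, hc', hc'0, hq'c₁⟩ := hβsome q' c' hq'c'
      by_cases hqq' : q = q'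
      · subst hqq'
        rw [hqc] at hq'c'
        exact Option.some.inj hq'c'
      · obtain ⟨s, hqs, hq's⟩ := D.exists_mem_bag_of_adj ((connGraph_adj g).2 ⟨hqq', a, hq, hq'⟩)
        exact eq_of_isBelow_of_isBelow g D hc hc0 hc' hc'0 (hbag_below q c s hqA hc hc0 hqc₁ hqs)
          (hbag_below q' c' s hq'A hc' hc'0 hq'c₁ hq's)
    -- every block is correctable (inside the subtree of a child)
    have hcorr : ∀ c, IsCorrectableRegion S (fiber β (some c)) := by
      intro c
      by_cases hne : (fiber β (some c)).Nonempty
      · obtain ⟨v, hv⟩ := hne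
        rw [mem_fiber] at hv
        obtain ⟨-, hc, hc0, -⟩ := hβsome v c hv
        refine (hchild c hc hc0).mono fun w hw => ?_
        rw [mem_fiber] at hw
        exact (hβsome w c hw).2.2.2
      · rw [not_nonempty_iff_eq_empty] at hne
        rw [hne]
        exact IsCorrectableRegion.of_card_lt hcode.2.2.1 (by rw [card_empty]; exact hd)
    have hAcorr : IsCorrectableRegion S A := by
      refine (isCorrectableRegion_of_fibers β g hS hsep hcorr).mono fun v hv => mem_filter.2 ⟨mem_univ _, ?_⟩
      simp [hβ, hv]
    -- the bag of t is small, and the Expansion Lemma closes the step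
    have hT : IsCorrectableRegion S (D.bag t) := IsCorrectableRegion.of_card_lt hcode.2.2.1 (hbags t)
    have hcov : CoversOuterBoundary g A (D.bag t) := coversOuterBoundary_below_sdiff g D t
    refine (hAcorr.union_of_coversOuterBoundary g hS hcode.1 hT hcov).mono fun v hv => ?_
    by_cases hvt : v ∈ D.bag t
    · exact mem_union_right _ hvt
    · exact mem_union_left _ (mem_sdiff.2 ⟨hv, hvt⟩)

end TreewidthBound

/-! ### Theorem 17 -/

variable {S : Submodule (ZMod 2) (SympVec n)} {k d : ℕ}

/-- **Baspin–Krishna 2022, Theorem 17 (as printed).** «Let 𝒞 be a code and G = G(𝒞) be the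
corresponding connectivity graph of bounded degree δ. If G has treewidth tw(G) then the distance obeys
d ≤ δ·(tw(G)+1).» For `[[n,k,d]]` stabilizer codes with `k ≥ 1` (the printed proof's «if the code is
to encode at least one logical qubit») and `δ ≥ 1` (implicit in print: for `δ = 0` the printed bound
reads `d ≤ 0`, false for the `[[1,1,1]]` code). Proof as printed: otherwise every bag of an optimal tree
decomposition has `≤ tw(G)+1 ≤ δ(tw(G)+1) < d` qubits, the contraction
`TreewidthBound.isCorrectableRegion_below` run up to the root makes the whole lattice correctable
(`TreewidthBound.below_root`), and `k = 0`. The degree hypothesis is carried but not used by this proof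
(see the module docstring; the degree-free consequence is recorded on the Summits side, not here).
[cite: BaspinKrishna2022, §3.1 Theorem 17 (arXiv:2106.00765 chunk p0011 L7–10; proof L12–66)] -/
theorem BaspinKrishna2022_theorem17 [DecidableRel (connGraph g).Adj] {δ : ℕ}
    (_hδ : ∀ v, (connGraph g).degree v ≤ δ) (hδ : 1 ≤ δ) (hcode : IsAdditiveCode S k d)
    (hS : S = Submodule.span (ZMod 2) (Set.range g)) (hk : 1 ≤ k) :
    d ≤ δ * (treewidth (connGraph g) + 1) := by
  obtain ⟨m, D, hD⟩ := Literature.Combinatorics.SimpleGraph.exists_width_eq_treewidth (connGraph g)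
  by_contra hlt
  rw [not_le] at hlt
  have hw : D.width + 1 < d := by
    rw [hD]
    exact lt_of_le_of_lt (le_mul_of_one_le_left (Nat.zero_le _) hδ) hlt
  have hbags : ∀ t, #(D.bag t) < d := fun t => lt_of_le_of_lt (D.card_bag_le_width_add_one t) hw
  have h := TreewidthBound.isCorrectableRegion_below g D hcode hS hbags D.root
  rw [TreewidthBound.below_root] at h
  exact not_isCorrectableRegion_univ hcode hk h

end Literature.InformationTheory.QuantumCodes
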